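import Summits.Ventures.PercRepro.RankLevelSetExplicitLin2KeyQuart

/-!
# PercRepro — THE LEVEL-10 QUART ROW OF C-025: THE KEY AT `p = 2 126` AND THE CONDITIONAL LEVEL STEP (p9, S4)

`proofs/SUBCLAIM-S4-p9.md` §S4.2⁗‴. The saturated row of record at level `10` is `p ≥ 8 710` (RankLevelSetExplicitLin2RowTen).
With p4's quart multiplicity the assembled inequality `(P_d)` holds, exactly evaluated, at EVERY core corank `11 ≤ d ≤ 1034`
from `p = 2 126` — and fails at `p = 2 125` (corank `629`, the big class's saturation corank):
the quart key `KeyQ 10 2126 d` (RankLevelSetExplicitLin2KeyQuart) is checked by the kernel at the 1 024 coranks (`decide`, 1 chunk of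
1 024), and `c025_level_succ_of_keyQ_row` turns the row into the level step
**`c025_ten_quart_step (hprev : ∀ M p, 2 125 ≤ p → RLS M p 9) : ∀ M p, 2 126 ≤ p → RLS M p 10`** (large-corank base 2 126 (LargeSharp),
tail `2 103`). The unconditional rows are composed in RankLevelSetExplicitLin2QuartFloor. Axioms: standard.
-/

open scoped Matroid

namespace PercRepro

namespace ThmN

namespace Explicit

/-- **THE QUART KEY ROW AT `(q, p) = (10, 2 126)`**: `KeyQ 10 2126 d` at every corank `11 ≤ d ≤ 1034`, by the kernel. -/
theorem key_ten_quart_row : ∀ t < 1024, KeyQ 10 2126 (11 + t) := by decide +kernel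

/-- **THE QUART FLOOR IS EXACT**: the quart key FAILS at `p = 2 125`, corank `629` (the big class's saturation corank), by the kernel. -/
theorem key_ten_quart_sharp : ¬ KeyQ 10 2125 629 := by decide +kernel

end Explicit

variable {α : Type}

/-- **THE LEVEL-10 QUART STEP FROM `2 126`**: level `10` for every finite matroid and every `p ≥ 2 126` from level `9` for
every `p ≥ 2 125` — the quart key row at `2 126`, its monotonicity in `p`, and the wrapper `c025_level_succ_of_keyQ_row`
(the large-corank theorem from the base `2 126` of regime one (`c025_level_succ_of_keyQ_row'`, RankLevelSetExplicitLin2LargeSharp: `N₁(10) = 2 292` would bind), tail `2 103 ≤ 2 126`). -/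
theorem c025_ten_quart_step (hprev : ∀ (M : Matroid α) [M.Finite] (p : ℕ), 2125 ≤ p → RLS M p 9) :
    ∀ (M : Matroid α) [M.Finite] (p : ℕ), 2126 ≤ p → RLS M p 10 :=
  c025_level_succ_of_keyQ_row' 9 (by norm_num) 2126 2126 le_rfl (by norm_num) (by decide +kernel) (by norm_num) (by norm_num)
    Explicit.key_ten_quart_row hprev

end ThmN

end PercRepro
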